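import Literature.NumberTheory.Rogawski1990.ArchEPAssemblyPartition          -- ★ (12′) E3b (LH3-p04 (g7)) p852221: `exists_classPartition_stableSumG` (product PoU + `α`-side localisation)
import Literature.NumberTheory.Rogawski1990.ArchEPAssemblyCore               -- ★ (12′) E3-CORE (LH3-p04 (g7)) p852223: `stableSumG_const_mul_family`
import Literature.NumberTheory.Rogawski1990.ArchBouazizPositiveTestFunctionG   -- ★ (7) F5 (LH7-p01 (g7)) p852002 §0: `ArchSmooth.finset_sum`
import Literature.NumberTheory.Rogawski1990.ArchChartOrbGOrbitCongr          -- ★ (c2) p852248 (F0P3b-p01 (g19)): `stableSumG_orbFamGExt_finset_sum_of_archSmooth` (ED. 2: `hAdd` discharged)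
import HarnessLib

/-!
# EP ASSEMBLY, FILE E3-SUM: the ball-by-ball transfers sum to H-S4′ — `(∀ ball J, ∃ f_J, SS_β(f_J) = κ · SS_α((ρ_J ∘ cl) · a′)) ⇒ ∃ f, SS_β(f) = SS(κ · orbFamGExt_α a′)`
# (Rogawski 1990 §14.2 (14.2.1); Shelstad 1979 §4; Bouaziz 1994 §6.2)

Topic `NumberTheory/Rogawski1990`; namespace `Literature.NumberTheory.Rogawski1990`.  THEOREMS ONLY (no `def`, no instance, no notation, no axiom, no named fact, no `sorry`).
Cell `pub/hodgecm-mathlib`, crux H413 (`stmt-HodgeConjecture-24833`), F0∕P3c road «N8-INNER» ROAD B «EP road» (owner LH2-plan (g1)), brick (12′) «EP ASSEMBLY» (holder LH3-p04 (g7); CENSUS-E3 v1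
`F0/P3c/LH3/LH3-p04/g7/e3/CENSUS-E3.v1.LH3p04g7.md` §1(d)).  Count-neutral, gate-free: the per-ball transfer `hBall` (= FILE E3a, the discharge of ★ E3-CORE's four readings) and the
additivity of the `β`-side stable sum in the test function (`hAdd`, co-hand F0P3b-p01 (g19) `ArchChartOrbGOrbitCongr` (c2)) are HYPOTHESES here; the final file E3 `ArchEPAssembly` is
`stableSurjG_of_ballTransfer` applied to E3a's theorem, with `κ = 3^{-#D}` and the measure rescaling of ★ p852217 `ArchChartOrbGRescaling`.

THE MATHEMATICS.  Given `a′ ∈ C_c^∞(G′_∞)`: ★ E3b `exists_classPartition_stableSumG` (radii `ε`, the generators' radii) yields finitely many balls `J` with smooth class multipliers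
`ρ_J = Π_{v∈D} F_{v,J_v} ∘ (· v)` and `SS_α(a′) = Σ_J SS_α((ρ_J ∘ bzClassG α) · a′)` on every `RegG S`; `hBall` yields `f_J ∈ C_c^∞(G_∞)` with `SS_β(f_J) = κ · SS_α((ρ_J ∘ cl) · a′)`;
`f := Σ_J f_J` is a test function (★ `ArchSmooth.finset_sum`) and `SS_β(f) = Σ_J SS_β(f_J)` (`hAdd`) `= κ · Σ_J SS_α(a′_J) = κ · SS_α(a′) = SS(κ · orbFamGExt_α a′)` (★ `stableSumG_const_mul_family`).
* `stableSurjG_of_ballTransfer` — generic in the two frames `α, β`, the finite set `D` of `α`-definite places (`hD`), the radii `ε` and the constant `κ`.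
* ED. 2 (F0P3b-p01 (g19), LHref-N BOX #64 route (i), 2026-09-02): **`stableSurjG_of_ballTransfer_fixed`** — the same with the test function `a′` bound BEFORE the radii `ε`, so the
  consumer (E3a (L2)) may choose `ε := ε(a′)` (the Glaeser-local factorisation radius of ★ (B3) depends on the function); and **`stableSurjG_of_ballTransfer_fixed_of_ne_zero`** — the
  same with `hAdd` DISCHARGED by ★ (c2) `stableSumG_orbFamGExt_finset_sum_of_archSmooth` under `hβ : ∀ i, β i ≠ 0` (Harish-Chandra's compactness lemma on the `β`-atlas needs it;
  `β₀ = ![(2:L)⁻¹, 1, -(2:L)⁻¹]` has it), so that the E3 head carries no `hAdd` binder.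
HONEST LABEL: HC_CM is proved only modulo the 7 printed citations (2 remaining: hLiu418 = `stmt-HodgeConjecture-24832`, h413 = `stmt-HodgeConjecture-24833`) until rung 0 closes; H-S4′ is
unpaid until E3a (per-ball transfer) and `hAdd` land and the generator heads (8)(10) are ★.

## References
* [Rogawski1990] J. D. Rogawski, *Automorphic Representations of Unitary Groups in Three Variables*, Ann. of Math. Stud. 123 (1990), §14.2 (14.2.1) pp. 232–233 (transfer of `C_c^∞`
  functions between inner forms, assembled from local data), §8.2 p. 122.
* [Shelstad1979] D. Shelstad, *Characters and inner forms of a quasi-split group over ℝ*, Compositio Math. 39 (1979), §4 pp. 22–26 (the transfer `f ↦ f^H` by a partition of unity on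
  the regular set).
* [Bouaziz1994IntegralesOrbitales] A. Bouaziz, *Intégrales orbitales sur les groupes de Lie réductifs*, Ann. Sci. ÉNS (4) 27 (1994), §6.2 pp. 591–594.
* [BorelJacquet1979] A. Borel, H. Jacquet, *Automorphic forms and automorphic representations*, Proc. Sympos. Pure Math. 33 (1979), part 1, §4.1.
-/

set_option autoImplicit false

noncomputable section

open MeasureTheory NumberField NumberField.InfinitePlace Complex Set Function Metric
open Literature.NumberTheory.Automorphic Literature.NumberTheory.Automorphic.UnitaryGroup Literature.NumberTheory.Automorphic.ArchCartan
open scoped Classical MatrixGroups Matrix ContDiff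

namespace Literature.NumberTheory.Rogawski1990

section Sum

variable (L : Type) [Field L] [NumberField L] [IsCMField L] (α β : Fin 3 → L)
  [MeasurableSpace ↥(arch (↥(maximalRealSubfield L)) L (IsCMField.complexConj L) 3 (Matrix.diagonal α))] [BorelSpace ↥(arch (↥(maximalRealSubfield L)) L (IsCMField.complexConj L) 3 (Matrix.diagonal α))]
  [MeasurableSpace ↥(arch (↥(maximalRealSubfield L)) L (IsCMField.complexConj L) 3 (Matrix.diagonal β))] [BorelSpace ↥(arch (↥(maximalRealSubfield L)) L (IsCMField.complexConj L) 3 (Matrix.diagonal β))]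
  (ν' : Measure ↥(arch (↥(maximalRealSubfield L)) L (IsCMField.complexConj L) 3 (Matrix.diagonal α))) [IsFiniteMeasureOnCompacts ν'] [ν'.IsMulRightInvariant]
  (νβ : Measure ↥(arch (↥(maximalRealSubfield L)) L (IsCMField.complexConj L) 3 (Matrix.diagonal β))) [IsFiniteMeasureOnCompacts νβ] [νβ.IsMulRightInvariant]

/-- **THE BALL-BY-BALL TRANSFERS SUM TO H-S4′.**  Let `D` be the `α`-definite places (`hD`), `ε` positive radii on class space (the one-place generators' radii), `κ` a constant.  Suppose
(`hBall`, FILE E3a) that for every choice of centres `ctr v ∈ K` and smooth factors `F v` supported in `ball (ctr v) (ε v (ctr v))` (`v ∈ D`) and every `a′ ∈ C_c^∞(G′_∞)` there is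
`f ∈ C_c^∞(G_∞)` with `SS_β(f) = κ · SS_α((Π_v F v ∘ cl_v) · a′)` on every `RegG S`, and (`hAdd`) that `f ↦ SS_β(f)` is additive over finite sums of test functions on `RegG S`.  Then for
every `a′ ∈ C_c^∞(G′_∞)` there is `f ∈ C_c^∞(G_∞)` with `stableSumG (orbFamGExt β νβ f) S c = stableSumG (fun S′ c′ => κ · orbFamGExt α ν′ a′ S′ c′) S c` for all `S`, `c ∈ RegG S` —
the `hSurj` sentence of the junction ★ p852077 (there `β = β₀`, `κ = 3^{-#D}`). [cite: Rogawski1990, §14.2 (14.2.1) p. 232] [cite: Shelstad1979, §4 p. 24] [cite: Bouaziz1994IntegralesOrbitales, §6.2 p. 591] -/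
theorem stableSurjG_of_ballTransfer (D : Finset {w : InfinitePlace L // IsComplex w}) (hD : ∀ w, w ∈ D ↔ w ∉ splitChartPlaces L α)
    (ε : {w : InfinitePlace L // IsComplex w} → ℂ × ℂ × ℂ → ℝ) (hε : ∀ w b, 0 < ε w b) (κ : ℂ)
    (hBall : ∀ (ctr : ↥D → ℂ × ℂ × ℂ) (F : ↥D → ℂ × ℂ × ℂ → ℝ),
      (∀ v, ctr v ∈ Set.range fun t : Fin 3 → ℝ => esymm3 fun i => Complex.exp ((t i : ℂ) * I)) → (∀ v, ContDiff ℝ ∞ (F v)) →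
      (∀ v, tsupport (F v) ⊆ ball (ctr v) (ε v (ctr v))) →
      ∀ a' : ↥(arch (↥(maximalRealSubfield L)) L (IsCMField.complexConj L) 3 (Matrix.diagonal α)) → ℂ, ArchSmooth L 3 (Matrix.diagonal α) a' →
        ∃ f : ↥(arch (↥(maximalRealSubfield L)) L (IsCMField.complexConj L) 3 (Matrix.diagonal β)) → ℂ, ArchSmooth L 3 (Matrix.diagonal β) f ∧
          ∀ (S : Finset {w : InfinitePlace L // IsComplex w}) (c : {w : InfinitePlace L // IsComplex w} → Fin 3 → ℝ), c ∈ RegG S →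
            stableSumG (orbFamGExt L β νβ f) S c =
              κ * stableSumG (orbFamGExt L α ν' (fun k => ((∏ v, F v (bzClassG L α k v) : ℝ) : ℂ) * a' k)) S c)
    (hAdd : ∀ {ι : Type} (s : Finset ι) (f : ι → ↥(arch (↥(maximalRealSubfield L)) L (IsCMField.complexConj L) 3 (Matrix.diagonal β)) → ℂ),
      (∀ i ∈ s, ArchSmooth L 3 (Matrix.diagonal β) (f i)) →
      ∀ (S : Finset {w : InfinitePlace L // IsComplex w}) (c : {w : InfinitePlace L // IsComplex w} → Fin 3 → ℝ), c ∈ RegG S →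
        stableSumG (orbFamGExt L β νβ (∑ i ∈ s, f i)) S c = ∑ i ∈ s, stableSumG (orbFamGExt L β νβ (f i)) S c)
    (a' : ↥(arch (↥(maximalRealSubfield L)) L (IsCMField.complexConj L) 3 (Matrix.diagonal α)) → ℂ) (ha' : ArchSmooth L 3 (Matrix.diagonal α) a') :
    ∃ f : ↥(arch (↥(maximalRealSubfield L)) L (IsCMField.complexConj L) 3 (Matrix.diagonal β)) → ℂ, ArchSmooth L 3 (Matrix.diagonal β) f ∧
      ∀ (S : Finset {w : InfinitePlace L // IsComplex w}) (c : {w : InfinitePlace L // IsComplex w} → Fin 3 → ℝ), c ∈ RegG S →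
        stableSumG (orbFamGExt L β νβ f) S c = stableSumG (fun S' c' => κ * orbFamGExt L α ν' a' S' c') S c := by
  -- the class partition of the `α`-side stable sum (E3b)
  obtain ⟨n, ctr, F, hF, -, -, -, hdec⟩ := exists_classPartition_stableSumG L α ν' D hD ε hε
  -- per ball: the transfer
  have hJ : ∀ J : (∀ v : ↥D, Fin (n v)), ∃ f : ↥(arch (↥(maximalRealSubfield L)) L (IsCMField.complexConj L) 3 (Matrix.diagonal β)) → ℂ,
      ArchSmooth L 3 (Matrix.diagonal β) f ∧
        ∀ (S : Finset {w : InfinitePlace L // IsComplex w}) (c : {w : InfinitePlace L // IsComplex w} → Fin 3 → ℝ), c ∈ RegG S →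
          stableSumG (orbFamGExt L β νβ f) S c =
            κ * stableSumG (orbFamGExt L α ν' (fun k => ((∏ v, F v (J v) (bzClassG L α k v) : ℝ) : ℂ) * a' k)) S c :=
    fun J => hBall (fun v => ctr v (J v)) (fun v => F v (J v)) (fun v => (hF v (J v)).1) (fun v => (hF v (J v)).2.1) (fun v => (hF v (J v)).2.2.2.1) a' ha'
  choose f hf hfS using hJ
  refine ⟨∑ J ∈ Finset.univ, f J, ArchSmooth.finset_sum L Finset.univ (fun J _ => hf J), fun S c hc => ?_⟩
  rw [hAdd Finset.univ f (fun J _ => hf J) S c hc, stableSumG_const_mul_family, hdec a' S c hc, Finset.mul_sum]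
  exact Finset.sum_congr rfl fun J _ => hfS J S c hc

end Sum

/-! ## ED. 2 — the test function bound before the radii; `hAdd` discharged by ★ (c2) -/

section Fixed

variable (L : Type) [Field L] [NumberField L] [IsCMField L] (α β : Fin 3 → L)
  [MeasurableSpace ↥(arch (↥(maximalRealSubfield L)) L (IsCMField.complexConj L) 3 (Matrix.diagonal α))] [BorelSpace ↥(arch (↥(maximalRealSubfield L)) L (IsCMField.complexConj L) 3 (Matrix.diagonal α))]
  [MeasurableSpace ↥(arch (↥(maximalRealSubfield L)) L (IsCMField.complexConj L) 3 (Matrix.diagonal β))] [BorelSpace ↥(arch (↥(maximalRealSubfield L)) L (IsCMField.complexConj L) 3 (Matrix.diagonal β))]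
  (ν' : Measure ↥(arch (↥(maximalRealSubfield L)) L (IsCMField.complexConj L) 3 (Matrix.diagonal α))) [IsFiniteMeasureOnCompacts ν'] [ν'.IsMulRightInvariant]
  (νβ : Measure ↥(arch (↥(maximalRealSubfield L)) L (IsCMField.complexConj L) 3 (Matrix.diagonal β))) [IsFiniteMeasureOnCompacts νβ] [νβ.IsMulRightInvariant]

/-- **E3-SUM WITH THE TEST FUNCTION FIXED FIRST** (ED. 2, LHref-N BOX #64 route (i)): for ONE function `a′ : G′_∞ → ℂ` (its regularity lives inside `hBall`), radii `ε` (which may now depend on `a′`), a constant `κ`, the per-ball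
transfers `hBall` for THIS `a′`, and additivity `hAdd` of the `β`-side stable sum, there is `f ∈ C_c^∞(G_∞)` with `SS_β(f) S c = stableSumG (fun S′ c′ => κ · orbFamGExt α ν′ a′ S′ c′) S c`
on every `RegG S`.  Proof = ED. 1's, verbatim (ED. 1 used `hBall` only at the outer `a′`). [cite: Rogawski1990, §14.2 (14.2.1) p. 232] [cite: Shelstad1979, §4 p. 24]
[cite: Bouaziz1994IntegralesOrbitales, §6.2 p. 591] -/
theorem stableSurjG_of_ballTransfer_fixed (D : Finset {w : InfinitePlace L // IsComplex w}) (hD : ∀ w, w ∈ D ↔ w ∉ splitChartPlaces L α)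
    (a' : ↥(arch (↥(maximalRealSubfield L)) L (IsCMField.complexConj L) 3 (Matrix.diagonal α)) → ℂ)
    (ε : {w : InfinitePlace L // IsComplex w} → ℂ × ℂ × ℂ → ℝ) (hε : ∀ w b, 0 < ε w b) (κ : ℂ)
    (hBall : ∀ (ctr : ↥D → ℂ × ℂ × ℂ) (F : ↥D → ℂ × ℂ × ℂ → ℝ),
      (∀ v, ctr v ∈ Set.range fun t : Fin 3 → ℝ => esymm3 fun i => Complex.exp ((t i : ℂ) * I)) → (∀ v, ContDiff ℝ ∞ (F v)) →
      (∀ v, tsupport (F v) ⊆ ball (ctr v) (ε v (ctr v))) →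
        ∃ f : ↥(arch (↥(maximalRealSubfield L)) L (IsCMField.complexConj L) 3 (Matrix.diagonal β)) → ℂ, ArchSmooth L 3 (Matrix.diagonal β) f ∧
          ∀ (S : Finset {w : InfinitePlace L // IsComplex w}) (c : {w : InfinitePlace L // IsComplex w} → Fin 3 → ℝ), c ∈ RegG S →
            stableSumG (orbFamGExt L β νβ f) S c =
              κ * stableSumG (orbFamGExt L α ν' (fun k => ((∏ v, F v (bzClassG L α k v) : ℝ) : ℂ) * a' k)) S c)
    (hAdd : ∀ {ι : Type} (s : Finset ι) (f : ι → ↥(arch (↥(maximalRealSubfield L)) L (IsCMField.complexConj L) 3 (Matrix.diagonal β)) → ℂ),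
      (∀ i ∈ s, ArchSmooth L 3 (Matrix.diagonal β) (f i)) →
      ∀ (S : Finset {w : InfinitePlace L // IsComplex w}) (c : {w : InfinitePlace L // IsComplex w} → Fin 3 → ℝ), c ∈ RegG S →
        stableSumG (orbFamGExt L β νβ (∑ i ∈ s, f i)) S c = ∑ i ∈ s, stableSumG (orbFamGExt L β νβ (f i)) S c) :
    ∃ f : ↥(arch (↥(maximalRealSubfield L)) L (IsCMField.complexConj L) 3 (Matrix.diagonal β)) → ℂ, ArchSmooth L 3 (Matrix.diagonal β) f ∧
      ∀ (S : Finset {w : InfinitePlace L // IsComplex w}) (c : {w : InfinitePlace L // IsComplex w} → Fin 3 → ℝ), c ∈ RegG S →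
        stableSumG (orbFamGExt L β νβ f) S c = stableSumG (fun S' c' => κ * orbFamGExt L α ν' a' S' c') S c := by
  -- the class partition of the `α`-side stable sum (E3b)
  obtain ⟨n, ctr, F, hF, -, -, -, hdec⟩ := exists_classPartition_stableSumG L α ν' D hD ε hε
  -- per ball: the transfer
  have hJ : ∀ J : (∀ v : ↥D, Fin (n v)), ∃ f : ↥(arch (↥(maximalRealSubfield L)) L (IsCMField.complexConj L) 3 (Matrix.diagonal β)) → ℂ,
      ArchSmooth L 3 (Matrix.diagonal β) f ∧
        ∀ (S : Finset {w : InfinitePlace L // IsComplex w}) (c : {w : InfinitePlace L // IsComplex w} → Fin 3 → ℝ), c ∈ RegG S →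
          stableSumG (orbFamGExt L β νβ f) S c =
            κ * stableSumG (orbFamGExt L α ν' (fun k => ((∏ v, F v (J v) (bzClassG L α k v) : ℝ) : ℂ) * a' k)) S c :=
    fun J => hBall (fun v => ctr v (J v)) (fun v => F v (J v)) (fun v => (hF v (J v)).1) (fun v => (hF v (J v)).2.1) (fun v => (hF v (J v)).2.2.2.1)
  choose f hf hfS using hJ
  refine ⟨∑ J ∈ Finset.univ, f J, ArchSmooth.finset_sum L Finset.univ (fun J _ => hf J), fun S c hc => ?_⟩
  rw [hAdd Finset.univ f (fun J _ => hf J) S c hc, stableSumG_const_mul_family, hdec a' S c hc, Finset.mul_sum]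
  exact Finset.sum_congr rfl fun J _ => hfS J S c hc

/-- **E3-SUM, TEST FUNCTION FIXED, `hAdd` DISCHARGED** (ED. 2): as `stableSurjG_of_ballTransfer_fixed`, with the additivity of the `β`-side stable sum supplied by ★ (c2)
`stableSumG_orbFamGExt_finset_sum_of_archSmooth` under `hβ : ∀ i, β i ≠ 0` — the form the E3 head `ArchEPAssembly` composes with, so that its only binders are `hEP` and the not-yet-★
slices. [cite: Rogawski1990, §14.2 (14.2.1) p. 232] [cite: Shelstad1979, §4 p. 24; Lemma 4.2 p. 23] [cite: Bouaziz1994IntegralesOrbitales, §6.2 p. 591] -/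
theorem stableSurjG_of_ballTransfer_fixed_of_ne_zero (hβ : ∀ i, β i ≠ 0) (D : Finset {w : InfinitePlace L // IsComplex w}) (hD : ∀ w, w ∈ D ↔ w ∉ splitChartPlaces L α)
    (a' : ↥(arch (↥(maximalRealSubfield L)) L (IsCMField.complexConj L) 3 (Matrix.diagonal α)) → ℂ)
    (ε : {w : InfinitePlace L // IsComplex w} → ℂ × ℂ × ℂ → ℝ) (hε : ∀ w b, 0 < ε w b) (κ : ℂ)
    (hBall : ∀ (ctr : ↥D → ℂ × ℂ × ℂ) (F : ↥D → ℂ × ℂ × ℂ → ℝ),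
      (∀ v, ctr v ∈ Set.range fun t : Fin 3 → ℝ => esymm3 fun i => Complex.exp ((t i : ℂ) * I)) → (∀ v, ContDiff ℝ ∞ (F v)) →
      (∀ v, tsupport (F v) ⊆ ball (ctr v) (ε v (ctr v))) →
        ∃ f : ↥(arch (↥(maximalRealSubfield L)) L (IsCMField.complexConj L) 3 (Matrix.diagonal β)) → ℂ, ArchSmooth L 3 (Matrix.diagonal β) f ∧
          ∀ (S : Finset {w : InfinitePlace L // IsComplex w}) (c : {w : InfinitePlace L // IsComplex w} → Fin 3 → ℝ), c ∈ RegG S →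
            stableSumG (orbFamGExt L β νβ f) S c =
              κ * stableSumG (orbFamGExt L α ν' (fun k => ((∏ v, F v (bzClassG L α k v) : ℝ) : ℂ) * a' k)) S c) :
    ∃ f : ↥(arch (↥(maximalRealSubfield L)) L (IsCMField.complexConj L) 3 (Matrix.diagonal β)) → ℂ, ArchSmooth L 3 (Matrix.diagonal β) f ∧
      ∀ (S : Finset {w : InfinitePlace L // IsComplex w}) (c : {w : InfinitePlace L // IsComplex w} → Fin 3 → ℝ), c ∈ RegG S →
        stableSumG (orbFamGExt L β νβ f) S c = stableSumG (fun S' c' => κ * orbFamGExt L α ν' a' S' c') S c :=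
  stableSurjG_of_ballTransfer_fixed L α β ν' νβ D hD a' ε hε κ hBall (stableSumG_orbFamGExt_finset_sum_of_archSmooth L β νβ hβ)

/-- **ED. 1's head with `hAdd` DISCHARGED** (radii before the test function, as in ED. 1; additivity from ★ (c2) under `hβ : ∀ i, β i ≠ 0`). [cite: Rogawski1990, §14.2 (14.2.1) p. 232]
[cite: Shelstad1979, §4 p. 24] -/
theorem stableSurjG_of_ballTransfer_of_ne_zero (hβ : ∀ i, β i ≠ 0) (D : Finset {w : InfinitePlace L // IsComplex w}) (hD : ∀ w, w ∈ D ↔ w ∉ splitChartPlaces L α)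
    (ε : {w : InfinitePlace L // IsComplex w} → ℂ × ℂ × ℂ → ℝ) (hε : ∀ w b, 0 < ε w b) (κ : ℂ)
    (hBall : ∀ (ctr : ↥D → ℂ × ℂ × ℂ) (F : ↥D → ℂ × ℂ × ℂ → ℝ),
      (∀ v, ctr v ∈ Set.range fun t : Fin 3 → ℝ => esymm3 fun i => Complex.exp ((t i : ℂ) * I)) → (∀ v, ContDiff ℝ ∞ (F v)) →
      (∀ v, tsupport (F v) ⊆ ball (ctr v) (ε v (ctr v))) →
      ∀ a' : ↥(arch (↥(maximalRealSubfield L)) L (IsCMField.complexConj L) 3 (Matrix.diagonal α)) → ℂ, ArchSmooth L 3 (Matrix.diagonal α) a' →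
        ∃ f : ↥(arch (↥(maximalRealSubfield L)) L (IsCMField.complexConj L) 3 (Matrix.diagonal β)) → ℂ, ArchSmooth L 3 (Matrix.diagonal β) f ∧
          ∀ (S : Finset {w : InfinitePlace L // IsComplex w}) (c : {w : InfinitePlace L // IsComplex w} → Fin 3 → ℝ), c ∈ RegG S →
            stableSumG (orbFamGExt L β νβ f) S c =
              κ * stableSumG (orbFamGExt L α ν' (fun k => ((∏ v, F v (bzClassG L α k v) : ℝ) : ℂ) * a' k)) S c)
    (a' : ↥(arch (↥(maximalRealSubfield L)) L (IsCMField.complexConj L) 3 (Matrix.diagonal α)) → ℂ) (ha' : ArchSmooth L 3 (Matrix.diagonal α) a') :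
    ∃ f : ↥(arch (↥(maximalRealSubfield L)) L (IsCMField.complexConj L) 3 (Matrix.diagonal β)) → ℂ, ArchSmooth L 3 (Matrix.diagonal β) f ∧
      ∀ (S : Finset {w : InfinitePlace L // IsComplex w}) (c : {w : InfinitePlace L // IsComplex w} → Fin 3 → ℝ), c ∈ RegG S →
        stableSumG (orbFamGExt L β νβ f) S c = stableSumG (fun S' c' => κ * orbFamGExt L α ν' a' S' c') S c :=
  stableSurjG_of_ballTransfer L α β ν' νβ D hD ε hε κ hBall (stableSumG_orbFamGExt_finset_sum_of_archSmooth L β νβ hβ) a' ha'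

end Fixed

end Literature.NumberTheory.Rogawski1990

end
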